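import Summits.BirchSwinnertonDyer.BirchSwinnertonDyer.Theses.TangentCone

/-!
# `EdgeDecay` — negative lemma: the crux plus `EdgeCap` is UB at one admissible prime (reduction)

Crux `TangentCone.EdgeDecay` (stmt-BirchSwinnertonDyer-17608). Load-bearing analysis of the analytic
rank in the decay exponent `r_an·(m+1) + C` (cdisprove seat, cycle 1; extracted from the certified glue
`TangentCone.closes`): together with the cap crux `EdgeCap` (edge ratios decay at rate `≥ s_p`), `EdgeDecay`
yields, for every globally minimal elliptic `W` with `r_an ≥ 2` and a big-image ordinary prime, an ADMISSIBLE
prime `p` (good ordinary `≥ 5`, `a_p² ≢ 1`, `ρ̄` onto, (Br)) with `corank_ℤₚ Sel_p∞(E/ℚ) ≤ r_an(E)` — the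
upper-bound half of Selmer-rank BSD at that prime (`selmerUB_at_admissible_of_edgeDecay_of_edgeCap`).
Contrapositive (`edgeDecay_false_of_edgeCap_of_corankExcess`): granted `EdgeCap`, a single such curve whose
Selmer corank exceeds `r_an` at EVERY admissible prime refutes `EdgeDecay`. Neither theorem asserts a route
item; both are sorry-free over Mathlib + the route file.
-/

set_option linter.dupNamespace false

namespace Summit.BirchSwinnertonDyer.BirchSwinnertonDyer.Theorems.EdgeDecay.Negative

open Summit.BirchSwinnertonDyer.BirchSwinnertonDyer.Theses.TangentCone

/-- **Reduction.** `EdgeDecay ∧ EdgeCap ⇒` UB (`s_p ≤ r_an`) at one admissible prime (with (Br)) of every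
globally minimal elliptic curve of analytic rank `≥ 2` having a big-image good ordinary prime `≥ 5`. The
squeeze `s_p(1+m) ≤ r_an(m+1) + C₁ + C₂` for all `m` is the one certified in `TangentCone.closes`.
[folklore] -/
theorem selmerUB_at_admissible_of_edgeDecay_of_edgeCap (hE : EdgeDecay) (hC : EdgeCap)
    (W : WeierstrassCurve ℚ) [W.IsElliptic] [W.IsGloballyMinimal] (h2 : 2 ≤ W.analyticRank)
    (hb : (∃ (p₀ : ℕ) (_ : Fact p₀.Prime), 5 ≤ p₀ ∧ W.HasGoodReductionAtPrime p₀ ∧ ¬ (p₀ : ℤ) ∣ W.frobeniusTrace p₀ ∧ W.HasSurjectiveModNGaloisRep p₀)) :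
    ∃ (_ : NeZero (W.conductorNorm ℤ)) (p : ℕ) (_ : Fact p.Prime), (5 ≤ p ∧ W.HasGoodReductionAtPrime p ∧ ¬ (p : ℤ) ∣ W.frobeniusTrace p ∧ ¬ (p : ℤ) ∣ (W.frobeniusTrace p) ^ 2 - 1 ∧ W.HasSurjectiveModNGaloisRep p ∧ (∀ (M : ℕ) (_ : NeZero M) (g : CuspForm (CongruenceSubgroup.Gamma0 M) 2) (ι : Literature.NumberTheory.EllipticCurves.ModularForms.coeffField g →+* PadicAlgCl p), M ∣ W.conductorNorm ℤ * p → Literature.NumberTheory.EllipticCurves.ModularForms.IsNewform0 g → ‖ι ⟨(UpperHalfPlane.qExpansion 1 ⇑g).coeff p, Literature.NumberTheory.EllipticCurves.ModularForms.coeff_mem_coeffField g p⟩‖ = 1 → (∀ ℓ : ℕ, ℓ.Prime → ¬ ℓ ∣ W.conductorNorm ℤ * p → ‖ι ⟨(UpperHalfPlane.qExpansion 1 ⇑g).coeff ℓ, Literature.NumberTheory.EllipticCurves.ModularForms.coeff_mem_coeffField g ℓ⟩ - ((W.frobeniusTrace ℓ : ℤ) : PadicAlgCl p)‖ < 1) →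 M = W.conductorNorm ℤ ∧ ∀ n : ℕ, (UpperHalfPlane.qExpansion 1 ⇑g).coeff n = ((W.LFunction n : ℤ) : ℂ))) ∧ W.selmerCorank p ≤ W.analyticRank := by
  obtain ⟨hN, p, hp, h5', hgood', hord', hna, hsurj', hBr, a, b, hb0, hab, hJ⟩ := hE W h2 hb
  refine ⟨hN, p, hp, ⟨h5', hgood', hord', hna, hsurj', hBr⟩, ?_⟩
  obtain ⟨J, C₁, hcap⟩ := hC W hN p h5' hgood' hord' hna hsurj' hBr a b hb0 hab
  obtain ⟨C₂, hm⟩ := hJ J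
  have hp1 : (1 : ℝ) < (p : ℝ) := by exact_mod_cast hp.out.one_lt
  have hp0 : (0 : ℝ) < (p : ℝ) := lt_trans zero_lt_one hp1
  have key : ∀ m : ℕ, W.selmerCorank p * (1 + m) ≤ W.analyticRank * (m + 1) + (C₁ + C₂) := by
    intro m
    obtain ⟨k, g, ι, s, hdiv, hkJ, hs, hnew, hordg, hcong, hall⟩ := hm m
    have hdiv' : (2 * b * (p - 1) : ℤ) ∣ (k - 2) := (Dvd.intro _ rfl).trans hdiv
    obtain ⟨j, hjodd, hj3, hjJ, hcapj⟩ := hcap k g ι s hdiv' hkJ hs hnew hordg hcong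
    obtain ⟨hR, hlow⟩ := hall j hjodd hj3 hjJ
    have hup := hcapj hR
    have hk0 : (k - 2) ≠ 0 := by omega
    have hpm : ((p : ℤ) ^ m) ∣ (k - 2) := (Dvd.intro_left _ rfl).trans hdiv
    have hmv : m ≤ padicValInt p (k - 2) := by
      rcases (padicValInt_dvd_iff m (k - 2)).mp hpm with h | h
      · exact absurd h hk0
      · exact h
    set x : ℝ := ‖ι ⟨_, hR⟩‖ with hx
    set e₁ : ℕ := W.selmerCorank p * (1 + padicValInt p (k - 2)) with he₁
    set e₂ : ℕ := W.analyticRank * (m + 1) + C₂ with he₂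
    have hpow : (p : ℝ) ^ e₁ ≤ (p : ℝ) ^ (C₁ + e₂) := by
      calc (p : ℝ) ^ e₁ = (p : ℝ) ^ e₁ * 1 := by ring
        _ ≤ (p : ℝ) ^ e₁ * (x * (p : ℝ) ^ e₂) :=
            mul_le_mul_of_nonneg_left hlow (pow_nonneg hp0.le _)
        _ = (x * (p : ℝ) ^ e₁) * (p : ℝ) ^ e₂ := by ring
        _ ≤ (p : ℝ) ^ C₁ * (p : ℝ) ^ e₂ :=
            mul_le_mul_of_nonneg_right hup (pow_nonneg hp0.le _)
        _ = (p : ℝ) ^ (C₁ + e₂) := (pow_add (p : ℝ) C₁ e₂).symm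
    have hexp : e₁ ≤ C₁ + e₂ := (pow_le_pow_iff_right₀ hp1).mp hpow
    have hmono : W.selmerCorank p * (1 + m) ≤ e₁ :=
      Nat.mul_le_mul_left _ (by omega)
    omega
  have hk := key (C₁ + C₂)
  by_contra hlt
  push Not at hlt
  have h1 : (W.analyticRank + 1) * (1 + (C₁ + C₂)) ≤ W.selmerCorank p * (1 + (C₁ + C₂)) :=
    Nat.mul_le_mul_right _ hlt
  nlinarith

/-- **Contrapositive (load-bearing analysis of `r_an`).** Granted `EdgeCap`, one globally minimal elliptic
curve of analytic rank `≥ 2` with a big-image ordinary prime whose `p^∞`-Selmer corank EXCEEDS `r_an` at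
every admissible prime (e.g. `Ш[p^∞]` infinite at all of them, or `rank E(ℚ) > r_an` — neither is expected
to exist) refutes `EdgeDecay`: the analytic rank in the exponent is load-bearing exactly as the UB half of
Selmer-rank BSD. [folklore] -/
theorem edgeDecay_false_of_edgeCap_of_corankExcess (hC : EdgeCap)
    (W : WeierstrassCurve ℚ) [W.IsElliptic] [W.IsGloballyMinimal] (h2 : 2 ≤ W.analyticRank)
    (hb : (∃ (p₀ : ℕ) (_ : Fact p₀.Prime), 5 ≤ p₀ ∧ W.HasGoodReductionAtPrime p₀ ∧ ¬ (p₀ : ℤ) ∣ W.frobeniusTrace p₀ ∧ W.HasSurjectiveModNGaloisRep p₀))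
    (hX : ∀ (p : ℕ) [Fact p.Prime], 5 ≤ p → W.HasGoodReductionAtPrime p →
      ¬ (p : ℤ) ∣ W.frobeniusTrace p → ¬ (p : ℤ) ∣ (W.frobeniusTrace p) ^ 2 - 1 →
      W.HasSurjectiveModNGaloisRep p → W.analyticRank < W.selmerCorank p) :
    ¬ EdgeDecay := by
  intro hE
  obtain ⟨-, p, hp, ⟨h5, hgood, hord, hna, hsurj, -⟩, hle⟩ :=
    selmerUB_at_admissible_of_edgeDecay_of_edgeCap hE hC W h2 hb
  haveI := hp
  exact absurd hle (not_le.mpr (hX p h5 hgood hord hna hsurj))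

end Summit.BirchSwinnertonDyer.BirchSwinnertonDyer.Theorems.EdgeDecay.Negative
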